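import Summits.ValiantsHypothesis.ValiantsHypothesis.Theorems.BarrierLeverNaturalProofsSeparateVNPProjections

/-!
# Route BarrierLever — item `NaturalProofsSeparateVNP` (stmt-ValiantsHypothesis-18972):
# FREE pull-backs along renamings, and level reduction for re-framable target families
# (cell valiant-natproofs, seat val-np-p4; bears on ladder rung V4)

Sequel of `…NaturalProofsSeparateVNPProjections` (natural proofs against `VP` ascend along Valiant
projections, at the price level `a ↦ max a 2` for the pulled-back linear forms).  Here the special
case that costs NOTHING, used by `…NaturalProofsSeparateVNPPermanentLevelOne` to bring the permanent
normal form of item 18972 down to the item's own level one: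

* `Projections.aeval_elim_monomial`, `Projections.exists_pullback_free` — **pull-backs along
  RENAMING substitutions are free.**  If the substitution sends every frame variable to `0` or to a
  variable, injectively on the survivors (`x'_i ↦ (e i).elim 0 X`, `e : Fin n' → Option (Fin n)`),
  then `a^ν = x^{e_* ν}` or `0`, so each window-`n` coefficient of `P(a)` is ONE window-`n'`
  coefficient of `P` (or `0`) and the linear forms of `exists_pullback` collapse to single
  coefficient variables: `D'(coeff P) = D(coeff P(a))` (`deg P ≤ n'`) with `L(D') ≤ L(D)`,
  `deg D' ≤ deg D`.  (The tree's `…Level` is the instance "zero-padding `n ↦ 3n`".)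
* `Projections.centralBinom_mul_le` (Vandermonde: `C(2m,m)·C(2k,k) ≤ C(2(m+k),m+k)`),
  `Projections.centralBinom_pow_le` (`C(2n,n)^a ≤ C(2an,an)`) — the counting that lets a larger
  frame absorb a level.
* `Projections.naturalProofAgainstVP_one_of_reframing` — **level reduction for re-framable
  families.**  If `h` carries a level-`a` natural proof against `VP` (FSV regime) and, for all large
  `n`, `h_n` is a renaming substitution of some `Q_{n''}` at a polynomially larger frame
  (`n < n'' ≤ A(n+1)^B`, `deg Q_{n''} ≤ n''`) with `C(2n,n)^a ≤ C(2n'',n'')`, then `Q` carries a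
  LEVEL-ONE natural proof against `VP`: the free pull-back has size and degree `≤ N^a ≤ N''` and
  vanishes on `SmallCircuits ℂ n'' b` by the truncation argument of
  `naturalProofAgainstVP_of_projections` (`Border.truncation_mem_smallCircuits`, BCS Lemma (21.25)).

WHAT THIS IS NOT: item 18972 stays OPEN (parked on the crux, item 14610); nothing here is evidence
for `VP ≠ VNP` or for FSV Question 6 either way; folklore transfer principles (FSV 2018 Cor. 5,
GKSS 2017 §2), new only as kernel glue.

References: [ForbesShpilkaVolk2018] Def. 1, Cor. 5, Question 6; [Burgisser2000] Def. 2.6,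
Rem. 2.2, Rem. 2.7; [BurgisserClausenShokrollahi1997] Lemma (21.25); [GrochowKumarSaksSaraf2017] §2.
-/

-- layout Summits/ValiantsHypothesis/ValiantsHypothesis forces the duplicated namespace component
set_option linter.dupNamespace false

noncomputable section

namespace Summit.ValiantsHypothesis.ValiantsHypothesis.Theorems.BarrierLever.NaturalProofsSeparateVNP

open Literature.Barriers.ValiantsHypothesis Literature.Computability.AlgebraicComplexity MvPolynomial
open Summit.ValiantsHypothesis.ValiantsHypothesis.Theses

namespace Projections

/-! ### 1. Pull-backs along RENAMING substitutions are free -/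

section Free

variable {n n' : ℕ}

/-- The monomial `x^ν` under a renaming-or-zero substitution (`x'_i ↦ x_{e i}` or `x'_i ↦ 0`):
zero if `ν` touches a killed variable, else the monomial `x^{e_* ν}`. [folklore] -/
theorem aeval_elim_monomial (e : Fin n' → Option (Fin n)) (j : Fin n' → Fin n)
    (hj : ∀ i x, e i = some x → j i = x) (ν : Fin n' →₀ ℕ) :
    aeval (fun i => (e i).elim (0 : MvPolynomial (Fin n) ℂ) X) (monomial ν (1 : ℂ)) =
      if ∀ i ∈ ν.support, (e i).isSome then monomial (Finsupp.mapDomain j ν) 1 else 0 := by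
  classical
  rw [aeval_monomial, map_one, one_mul, Finsupp.prod]
  split_ifs with hlive
  · rw [← rename_monomial, ← prod_X_pow_eq_monomial, map_prod]
    refine Finset.prod_congr rfl fun i hi => ?_
    obtain ⟨x, hx⟩ := Option.isSome_iff_exists.mp (hlive i hi)
    rw [map_pow, rename_X, hx, hj i x hx]
    rfl
  · obtain ⟨i, hi, hnone⟩ : ∃ i ∈ ν.support, e i = none := by
      by_contra hcon
      apply hlive
      intro i hi
      cases hei : e i with
      | none => exact absurd ⟨i, hi, hei⟩ hcon
      | some x => rfl
    refine Finset.prod_eq_zero hi ?_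
    rw [hnone, Option.elim_none]
    exact zero_pow (Finsupp.mem_support_iff.mp hi)

/-- **Pull-back along a renaming substitution is FREE.** If the substitution sends each frame
variable `x'_i` either to `0` or to a variable `x_{e i}`, injectively on the surviving variables,
then the pulled-back distinguisher of `exists_pullback` can be taken of size `≤ L(D)` (and degree
`≤ deg D`): every one of its linear forms is a single coefficient variable or `0`, as each window-`n`
coefficient of `P(a)` is one window-`n'` coefficient of `P` (or `0`). This is the mechanism of the
tree's level reduction (`…Level`, zero-padding `n ↦ 3n`), for arbitrary renamings.
[cite: ForbesShpilkaVolk2018, Cor. 5] [cite: Burgisser2000, Rem. 2.2] -/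
theorem exists_pullback_free (hn : 0 < n) (e : Fin n' → Option (Fin n))
    (hinj : ∀ i i' x, e i = some x → e i' = some x → i = i')
    (D : MvPolynomial (degLEMonomials n) ℂ) :
    ∃ D' : MvPolynomial (degLEMonomials n') ℂ,
      (∀ P : MvPolynomial (Fin n') ℂ, P.totalDegree ≤ n' →
        eval (coeffVector (degLEMonomials n') P) D' =
          eval (coeffVector (degLEMonomials n)
            (aeval (fun i => (e i).elim (0 : MvPolynomial (Fin n) ℂ) X) P)) D) ∧
      complexity D' ≤ complexity D ∧ D'.totalDegree ≤ D.totalDegree := by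
  classical
  set a : Fin n' → MvPolynomial (Fin n) ℂ := fun i => (e i).elim (0 : MvPolynomial (Fin n) ℂ) X
    with ha
  -- a total version of `e` (junk value on killed variables)
  set j : Fin n' → Fin n := fun i => (e i).getD ⟨0, hn⟩ with hjdef
  have hj : ∀ i x, e i = some x → j i = x := fun i x hx => by simp [hjdef, hx]
  have hjinj : Set.InjOn j {i | (e i).isSome} := by
    intro i hi i' hi' hii'
    obtain ⟨x, hx⟩ := Option.isSome_iff_exists.mp hi
    obtain ⟨x', hx'⟩ := Option.isSome_iff_exists.mp hi'
    rw [hj i x hx, hj i' x' hx'] at hii'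
    subst hii'
    exact hinj i i' x hx hx'
  -- the coefficients `c μ ν = coeff_μ (a^ν)` are `0/1`, at most one `1` per `μ`
  set c : degLEMonomials n → degLEMonomials n' → ℂ := fun μ ν =>
    coeff (μ : Fin n →₀ ℕ) (aeval a (monomial (ν : Fin n' →₀ ℕ) (1 : ℂ))) with hc
  have hc01 : ∀ μ ν, c μ ν ≠ 0 →
      c μ ν = 1 ∧ (∀ i ∈ (ν : Fin n' →₀ ℕ).support, (e i).isSome) ∧
        Finsupp.mapDomain j (ν : Fin n' →₀ ℕ) = μ := by
    intro μ ν hne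
    have key : c μ ν = coeff (μ : Fin n →₀ ℕ)
        (if ∀ i ∈ (ν : Fin n' →₀ ℕ).support, (e i).isSome then
          monomial (Finsupp.mapDomain j (ν : Fin n' →₀ ℕ)) (1 : ℂ) else 0) := by
      rw [hc]; exact congrArg _ (aeval_elim_monomial e j hj _)
    by_cases hlive : ∀ i ∈ (ν : Fin n' →₀ ℕ).support, (e i).isSome
    · rw [if_pos hlive, coeff_monomial] at key
      by_cases heq : Finsupp.mapDomain j (ν : Fin n' →₀ ℕ) = μ
      · rw [if_pos heq] at key; exact ⟨key, hlive, heq⟩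
      · rw [if_neg heq] at key; exact absurd key hne
    · rw [if_neg hlive, coeff_zero] at key; exact absurd key hne
  have huniq : ∀ μ ν ν', c μ ν ≠ 0 → c μ ν' ≠ 0 → ν = ν' := by
    intro μ ν ν' h h'
    obtain ⟨-, hl, hm⟩ := hc01 μ ν h
    obtain ⟨-, hl', hm'⟩ := hc01 μ ν' h'
    apply Subtype.ext
    refine Finsupp.mapDomain_injOn {i | (e i).isSome} hjinj ?_ ?_ (hm.trans hm'.symm)
    · exact fun i hi => hl i (Finset.mem_coe.mp hi)
    · exact fun i hi => hl' i (Finset.mem_coe.mp hi)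
  -- the linear forms of `exists_pullback` collapse to a variable or zero
  set Φ : degLEMonomials n → MvPolynomial (degLEMonomials n') ℂ := fun μ =>
    ∑ ν : degLEMonomials n', C (c μ ν) * X ν with hΦ
  have hΦval : ∀ μ, Φ μ = 0 ∨ ∃ ν, Φ μ = X ν := by
    intro μ
    by_cases hex : ∃ ν, c μ ν ≠ 0
    · obtain ⟨ν₀, hν₀⟩ := hex
      right
      refine ⟨ν₀, ?_⟩
      rw [hΦ]
      dsimp only
      rw [Finset.sum_eq_single ν₀ (fun ν _ hne => ?_) (fun h => absurd (Finset.mem_univ _) h),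
        (hc01 μ ν₀ hν₀).1, C_1, one_mul]
      have : c μ ν = 0 := by
        by_contra hcν
        exact hne (huniq μ ν ν₀ hcν hν₀)
      rw [this, C_0, zero_mul]
    · left
      have hex' : ∀ ν, c μ ν = 0 := fun ν => by
        by_contra hcν
        exact hex ⟨ν, hcν⟩
      rw [hΦ]
      dsimp only
      exact Finset.sum_eq_zero fun ν _ => by rw [hex' ν, C_0, zero_mul]
  have hΦc : ∀ μ, complexity (Φ μ) = 0 := fun μ => by
    rcases hΦval μ with h0 | ⟨ν, hν⟩
    · rw [h0, ← C_0]; exact complexity_C_holds _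
    · rw [hν]; exact complexity_X_holds _
  have hΦd : ∀ μ, (Φ μ).totalDegree ≤ 1 := fun μ => by
    rcases hΦval μ with h0 | ⟨ν, hν⟩
    · rw [h0, totalDegree_zero]; exact Nat.zero_le _
    · rw [hν]; exact (totalDegree_X ν).le
  refine ⟨aeval Φ D, fun P hP => ?_, ?_, ?_⟩
  · have hfun : (fun μ => aeval (coeffVector (degLEMonomials n') P) (Φ μ)) =
        coeffVector (degLEMonomials n) (aeval a P) := by
      funext μ
      rw [aeval_eq_eval, hΦ]
      exact eval_coeffVector_linForm a hP μ
    rw [← aeval_eq_eval (coeffVector (degLEMonomials n') P), ← AlgHom.comp_apply, comp_aeval, hfun,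
      aeval_eq_eval]
  · calc complexity (aeval Φ D) ≤ complexity D + ∑ μ, complexity (Φ μ) := complexity_aeval_le _ _
      _ = complexity D := by simp [hΦc]
  · calc (aeval Φ D).totalDegree ≤ D.totalDegree * 1 :=
          Literature.RingTheory.Nullstellensatz.totalDegree_aeval_le Φ hΦd D
      _ = D.totalDegree := mul_one _

/-- A renaming-or-zero substitution is a Valiant projection (so it is free on circuit size).
[cite: Burgisser2000, Def. 2.6(1)] -/
theorem isProjection_aeval_elim (e : Fin n' → Option (Fin n)) (P : MvPolynomial (Fin n') ℂ) :
    IsProjection (aeval (fun i => (e i).elim (0 : MvPolynomial (Fin n) ℂ) X) P) P := by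
  refine ⟨_, fun i => ?_, rfl⟩
  cases h : e i with
  | none => exact Or.inr ⟨0, by rw [Option.elim_none, C_0]⟩
  | some x => exact Or.inl ⟨x, by rw [Option.elim_some]⟩

end Free

/-! ### 2. Counting: powers of `C(2n,n)` against one central binomial coefficient -/

section Counting

/-- Vandermonde: `C(2m,m) · C(2k,k) ≤ C(2(m+k), m+k)` (one term of the convolution).
[folklore] -/
theorem centralBinom_mul_le (m k : ℕ) :
    (2 * m).choose m * (2 * k).choose k ≤ (2 * (m + k)).choose (m + k) := by
  have h := Nat.add_choose_eq (2 * m) (2 * k) (m + k)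
  rw [show 2 * (m + k) = 2 * m + 2 * k by ring, h]
  exact Finset.single_le_sum (f := fun ij : ℕ × ℕ => (2 * m).choose ij.1 * (2 * k).choose ij.2)
    (fun _ _ => Nat.zero_le _) (a := (m, k)) (Finset.HasAntidiagonal.mem_antidiagonal.mpr rfl)

/-- Hence `C(2n,n)^a ≤ C(2an, an)`. [folklore] -/
theorem centralBinom_pow_le (n : ℕ) : ∀ a : ℕ, ((2 * n).choose n) ^ a ≤ (2 * (a * n)).choose (a * n)
  | 0 => by simp
  | a + 1 => by
      calc ((2 * n).choose n) ^ (a + 1) = ((2 * n).choose n) ^ a * (2 * n).choose n := pow_succ _ _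
        _ ≤ (2 * (a * n)).choose (a * n) * (2 * n).choose n :=
            Nat.mul_le_mul_right _ (centralBinom_pow_le n a)
        _ ≤ (2 * (a * n + n)).choose (a * n + n) := centralBinom_mul_le _ _
        _ = (2 * ((a + 1) * n)).choose ((a + 1) * n) := by rw [show (a + 1) * n = a * n + n by ring]

end Counting

/-! ### 3. Level reduction along free re-framings -/

section Reframe

/-- **Level reduction for re-framable families.** Let `h` carry a level-`a` natural proof against
`VP`, and suppose that for all large `n` the member `h_n` is obtained from some `Q_{n''}` at a
polynomially larger frame (`n < n'' ≤ A(n+1)^B`, `deg Q_{n''} ≤ n''`) by a RENAMING substitution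
(frame variables to distinct variables or to `0`), where the frame is large enough to absorb the
level: `C(2n,n)^a ≤ C(2n'',n'')`. Then `Q` carries a LEVEL-ONE natural proof against `VP`: the
free pull-back (`exists_pullback_free`) has size `≤ L(D) ≤ N^a ≤ N''` and degree `≤ N^a ≤ N''`,
and vanishes on `SmallCircuits ℂ n'' b` by the truncation argument of
`naturalProofAgainstVP_of_projections`. (The tree's `…Level` is the case `Q =` zero-padding of a
fixed non-root; here the non-root may be re-framed.) [cite: ForbesShpilkaVolk2018, Cor. 5 and Question 6] -/
theorem naturalProofAgainstVP_one_of_reframing {a : ℕ} {h Q : ∀ n, MvPolynomial (Fin n) ℂ}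
    (hnat : NaturalProofAgainstVP ℂ a h)
    (hQ : ∃ A B n₁ : ℕ, ∀ n : ℕ, n₁ ≤ n → ∃ n'' : ℕ, n < n'' ∧ n'' ≤ A * (n + 1) ^ B ∧
      (Q n'').totalDegree ≤ n'' ∧ ((2 * n).choose n) ^ a ≤ (2 * n'').choose n'' ∧
      ∃ e : Fin n'' → Option (Fin n), (∀ i i' x, e i = some x → e i' = some x → i = i') ∧
        h n = aeval (fun i => (e i).elim (0 : MvPolynomial (Fin n) ℂ) X) (Q n'')) :
    NaturalProofAgainstVP ℂ 1 Q := by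
  classical
  obtain ⟨A, B, n₁, hAB⟩ := hQ
  intro b n₀'
  obtain ⟨n₂, hn₂⟩ := Border.truncation_budget (A ^ b) (B * b)
  obtain ⟨n, hn, D, ⟨hDmem, -, hvan⟩, hne⟩ := hnat (B * b + 3) (max n₂ (max n₀' (n₁ + 1)))
  have hn1 : n₁ ≤ n := by
    have := (le_max_right _ _).trans ((le_max_right _ _).trans hn); omega
  have hnpos : 0 < n := by
    have := (le_max_right _ _).trans ((le_max_right _ _).trans hn); omega
  obtain ⟨n'', hnn'', hn''le, hQdeg, hcount, e, hinj, hhn⟩ := hAB n hn1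
  obtain ⟨D', hD'eval, hD'size, hD'deg⟩ := exists_pullback_free hnpos e hinj D
  have hval : eval (coeffVector (degLEMonomials n'') (Q n'')) D' =
      eval (coeffVector (degLEMonomials n) (h n)) D := by
    rw [hD'eval (Q n'') hQdeg, ← hhn]
  refine ⟨n'', ((le_max_left _ _).trans ((le_max_right _ _).trans hn)).trans hnn''.le, D',
    ⟨⟨?_, ?_⟩, ?_, ?_⟩, ?_⟩
  · rw [pow_one]
    exact hD'size.trans (hDmem.1.trans hcount)
  · rw [pow_one]
    exact hD'deg.trans (hDmem.2.trans hcount)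
  · intro h0
    apply hne
    rw [← hval, h0, map_zero]
  · intro f hf
    rw [hD'eval f hf.1, ← Border.coeffVector_truncation n (aeval _ f)]
    refine hvan _ (Border.truncation_mem_smallCircuits (R := A ^ b * (n + 1) ^ (B * b)) ?_
      (hn₂ n ((le_max_left _ _).trans hn)))
    calc complexity (aeval (fun i => (e i).elim (0 : MvPolynomial (Fin n) ℂ) X) f)
        ≤ complexity f := complexity_le_of_isProjection (isProjection_aeval_elim e f)
      _ ≤ n'' ^ b := hf.2
      _ ≤ (A * (n + 1) ^ B) ^ b := Nat.pow_le_pow_left hn''le b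
      _ = A ^ b * (n + 1) ^ (B * b) := by rw [mul_pow, ← pow_mul]
  · rw [hval]
    exact hne

end Reframe

end Projections

end Summit.ValiantsHypothesis.ValiantsHypothesis.Theorems.BarrierLever.NaturalProofsSeparateVNP

end
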